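import Summits.Langlands.Langlands.Theses.NonParallelVoid
import Literature.NumberTheory.Automorphic.CompletedCohomologyHeckeAlgebraGLn
import Literature.NumberTheory.Automorphic.ACCAutomorphyLiftingCrystalline
import HarnessLib

/-!
# Sketch for crux-ideate stmt-Langlands-17006 (NonParallelVoid.VoidToLanglands), round 1, ideator 1

Typed material for the two crux idea cards `defect-one-pincer-capture` and `eisenstein-cyclicity-corner`.
Everything here is a definition with a body or a sorry-free theorem (pure logic); nothing is claimed proved
about the mathematics.  `WeakParallelModularity` is VERBATIM the statement of the `Target`-fed stub
`stub_weakParallelModularity` of the registered line `Lines/satake_sector_cut.lean` (B_w⁺).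

* §1 local predicates (pinned-de Rham regular above `p`; parallel; `p ≥ 5` split; generic residue = some
  residual representation `τ` of `ρ` is absolutely irreducible, decomposed generic, absolutely irreducible on
  `Γ_{F(ζ_p)}`, and RESIDUALLY AUTOMORPHIC: `τ` is also a residual representation of an `r` with HLTT's
  characterising property of `r_ι(π)` for a cuspidal `π` — the ACC+ phrasing of `Literature…ACCAutomorphyLiftingCrystalline`).
* §2 B_w⁺ verbatim and its cut along the generic-split slice (card A) and along the residue (card B).
* §3 card A's two cruxes typed over the tree's completed-cohomology Hecke algebra
  (`BigHeckeGLn.TameLevel.IsPadicallyAutomorphic`): ENTRANCE `ProModularityGeneric` (big `R = 𝕋` at defect one ⇒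
  pro-modularity) and EXIT `ProModularDeRhamClassical` (pro-modular + pinned-de Rham regular ⇒ classical, weight-free),
  and the glue `weakParallelModularityOn_of` (pure logic).
* §4 card B's corner statement `EisensteinCornerFL` typed.
-/

set_option linter.unusedVariables false
set_option linter.dupNamespace false

noncomputable section

open scoped NumberField Classical
open Filter IsDedekindDomain NumberField Field
open Literature.NumberTheory.GaloisRepresentations Literature.NumberTheory.PAdicHodge
open Literature.NumberTheory.Automorphic
open Summit.Langlands

namespace Summit.Langlands.Langlands.Cruxes.VoidToLanglands.DefectOnePincer

/-! ## 1. Local predicates -/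

section Predicates

variable (F : Type) [Field F] [NumberField F] (p : ℕ) [Fact p.Prime]

/-- `ρ` is de Rham for the PINNED Fontaine datum at every `v ∣ p`, with two distinct `τ`-labelled
Hodge–Tate weights at every label (B_w⁺'s local hypothesis, same text). [folklore] -/
def DeRhamRegularAbove (ρ : FramedGaloisRep F (PadicAlgCl p) 2) : Prop :=
  (∀ (v : HeightOneSpectrum (𝓞 F)) (hv : ((p : ℕ) : 𝓞 F) ∈ v.asIdeal),
      (fontainePstAdicCompletion v p hv).IsDeRhamFramed (ρ.toLocal v)) ∧
    ∀ (v : HeightOneSpectrum (𝓞 F)) (hv : ((p : ℕ) : 𝓞 F) ∈ v.asIdeal),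
      letI := (fontainePstAdicCompletion v p hv).algebra
      ∀ τ : v.adicCompletion F →ₐ[ℚ_[p]] PadicAlgCl p, ∃ a b : ℤ, a < b ∧
        ρ.labelledHodgeTateWeightsAt v (fontainePstAdicCompletion v p hv).algebra
          (fontainePstAdicCompletion v p hv).𝔅 τ.toRingHom = {a, b}

/-- PARALLEL labelled weights: one common gap `g`. [folklore] -/
def Parallel (ρ : FramedGaloisRep F (PadicAlgCl p) 2) : Prop :=
  ∃ g : ℤ, ∀ (v : HeightOneSpectrum (𝓞 F)) (hv : ((p : ℕ) : 𝓞 F) ∈ v.asIdeal),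
    letI := (fontainePstAdicCompletion v p hv).algebra
    ∀ τ : v.adicCompletion F →ₐ[ℚ_[p]] PadicAlgCl p, ∃ a : ℤ,
      ρ.labelledHodgeTateWeightsAt v (fontainePstAdicCompletion v p hv).algebra
        (fontainePstAdicCompletion v p hv).𝔅 τ.toRingHom = {a, a + g}

/-- Parallel with gap at most `N` (Fontaine–Laffaille range is `N = p - 2`). [folklore] -/
def ParallelGapLE (ρ : FramedGaloisRep F (PadicAlgCl p) 2) (N : ℤ) : Prop :=
  ∃ g : ℤ, g ≤ N ∧ ∀ (v : HeightOneSpectrum (𝓞 F)) (hv : ((p : ℕ) : 𝓞 F) ∈ v.asIdeal),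
    letI := (fontainePstAdicCompletion v p hv).algebra
    ∀ τ : v.adicCompletion F →ₐ[ℚ_[p]] PadicAlgCl p, ∃ a : ℤ,
      ρ.labelledHodgeTateWeightsAt v (fontainePstAdicCompletion v p hv).algebra
        (fontainePstAdicCompletion v p hv).𝔅 τ.toRingHom = {a, a + g}

/-- `p ≥ 5` and `p` has (at least) two distinct places in `F` — for `F` imaginary quadratic: `p` splits,
so `F_v = ℚ_p` at both places (Colmez–Paškūnas available; the `ModPLanglandsGL2BeyondQp` barrier is off). [folklore] -/
def PSplit : Prop :=
  5 ≤ p ∧ ∃ v w : HeightOneSpectrum (𝓞 F), v ≠ w ∧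
    ((p : ℕ) : 𝓞 F) ∈ v.asIdeal ∧ ((p : ℕ) : 𝓞 F) ∈ w.asIdeal

/-- GENERIC RESIDUE (Taylor–Wiles / Gee–Newton standing hypotheses, ACC+ phrasing): some residual representation
`τ` of `ρ` is absolutely irreducible, decomposed generic, absolutely irreducible on `Γ_{F(ζ_p)}`, and RESIDUALLY
AUTOMORPHIC — `τ` is also a residual representation of an `r` having HLTT's characterising property of `r_ι(π)`
for a cuspidal `π` of `GL₂(𝔸_F)` (Serre's conjecture over `F` is NOT claimed: it is this hypothesis).
[cite: ACCGHLNSTT2023, Thm. 6.1.1 hypotheses (3)–(5)] [cite: GeeNewton2020, §3.3 standing hypotheses] -/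
def GenericResidue (ρ : FramedGaloisRep F (PadicAlgCl p) 2) : Prop :=
  ∃ τ : absoluteGaloisGroup F →* GL (Fin 2) (padicAlgClResidueField p),
    ρ.IsResidualRepOf (RingHom.id _) τ ∧ IsAbsIrreducible τ ∧ IsDecomposedGeneric τ ∧
      IsAbsIrreducible (τ.comp (absGaloisGroupAdjoinRootsOfUnity F p).subtype) ∧
      ∃ (hcpt : isCompact_glFiniteIntegralLevel 2 F) (ι : PadicAlgCl p ≃+* ℂ)
        (π : CuspidalAutomorphicRepData 2 F hcpt) (r : FramedGaloisRep F (PadicAlgCl p) 2),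
        HLTT.IsCompatible π.1 ι r ∧ r.IsResidualRepOf (RingHom.id _) τ

/-- The GENERIC-SPLIT SLICE of B_w⁺ on which card A's engine runs. [folklore] -/
def InSlice (ρ : FramedGaloisRep F (PadicAlgCl p) 2) : Prop :=
  PSplit F p ∧ GenericResidue F p ρ

end Predicates

/-! ## 2. B_w⁺ (verbatim) and its two cuts -/

/-- **B_w⁺ = `stub_weakParallelModularity` of `Lines/satake_sector_cut.lean`, VERBATIM** (the `Target`-fed stub of
the crux): Satake-level modularity of irreducible, a.e.-unramified, pinned-de Rham, regular, PARALLEL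
`ρ : Γ_F → GL₂(ℚ̄_ℓ)` over imaginary quadratic `F`. [cite: FontaineMazurGeometric1995, Conj. 1]
[cite: CalegariMazur2008, Conj. 1.3] -/
def WeakParallelModularity : Prop :=
  ∀ (F : Type) [Field F] [NumberField F] [Algebra.IsQuadraticExtension ℚ F], NumberField.IsTotallyComplex F → ∀ (hcpt : Literature.NumberTheory.Automorphic.isCompact_glFiniteIntegralLevel 2 F) (ℓ : ℕ) [Fact ℓ.Prime] (ι : PadicAlgCl ℓ ≃+* ℂ) (ρ : Literature.NumberTheory.GaloisRepresentations.FramedGaloisRep F (PadicAlgCl ℓ) 2), ρ.toGaloisRep.IsIrreducible → ((∀ᶠ v : IsDedekindDomain.HeightOneSpectrum (NumberField.RingOfIntegers F) in cofinite, ρ.IsUnramifiedAt v) ∧ ∀ (v : IsDedekindDomain.HeightOneSpectrum (NumberField.RingOfIntegers F)) (hv : ((ℓ : ℕ) : NumberField.RingOfIntegers F) ∈ v.asIdeal), (Literature.NumberTheory.PAdicHodge.fontainePstAdicCompletion v ℓ hv).IsDeRhamFramed (ρ.toLocal v)) → (∀ (v : IsDedekindDomain.HeightOneSpectrum (NumberField.RingOfIntegers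 F)) (hv : ((ℓ : ℕ) : NumberField.RingOfIntegers F) ∈ v.asIdeal), letI := (Literature.NumberTheory.PAdicHodge.fontainePstAdicCompletion v ℓ hv).algebra; ∀ τ : v.adicCompletion F →ₐ[ℚ_[ℓ]] PadicAlgCl ℓ, ∃ a b : ℤ, a < b ∧ ρ.labelledHodgeTateWeightsAt v (Literature.NumberTheory.PAdicHodge.fontainePstAdicCompletion v ℓ hv).algebra (Literature.NumberTheory.PAdicHodge.fontainePstAdicCompletion v ℓ hv).𝔅 τ.toRingHom = {a, b}) → (∃ g : ℤ, ∀ (v : IsDedekindDomain.HeightOneSpectrum (NumberField.RingOfIntegers F)) (hv : ((ℓ : ℕ) : NumberField.RingOfIntegers F) ∈ v.asIdeal), letI := (Literature.NumberTheory.PAdicHodge.fontainePstAdicCompletion v ℓ hv).algebra; ∀ τ : v.adicCompletion F →ₐ[ℚ_[ℓ]] PadicAlgCl ℓ, ∃ a : ℤ, ρ.labelledHodgeTateWeightsAt v (Literature.NumberTheory.PAdicHodge.fontainePstAdicCompletion v ℓ hv).algebra (Literature.NumberTheory.PAdicHodge.fontainePstAdicCompletion v ℓ hv).𝔅 τ.toRingHom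 = {a, a + g}) → ∃ π : Literature.NumberTheory.Automorphic.CuspidalAutomorphicRepData 2 F hcpt, π.1.IsLAlgebraic ∧ ∀ᶠ v : IsDedekindDomain.HeightOneSpectrum (NumberField.RingOfIntegers F) in cofinite, SatakeFrobCompatibleAt ι π.1 ρ v

/- By-name check (not imported here: the Lines module is not in the farm build):
   `example : WeakParallelModularity ↔ SatakeSectorCut._Goal.stub_weakParallelModularity := Iff.rfl`
   holds with `import Summits.Langlands.Langlands.Cruxes.VoidToLanglands.Lines.satake_sector_cut` — the text of
   `WeakParallelModularity` above is byte-for-byte that stub's statement. -/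

/-- B_w⁺ ON the generic-split slice (card A's region; `InSlice` added as the last hypothesis). [folklore] -/
def WeakParallelModularityOn : Prop :=
  ∀ (F : Type) [Field F] [NumberField F] [Algebra.IsQuadraticExtension ℚ F], NumberField.IsTotallyComplex F →
    ∀ (hcpt : isCompact_glFiniteIntegralLevel 2 F) (ℓ : ℕ) [Fact ℓ.Prime] (ι : PadicAlgCl ℓ ≃+* ℂ)
      (ρ : FramedGaloisRep F (PadicAlgCl ℓ) 2), ρ.toGaloisRep.IsIrreducible →
      ((∀ᶠ v : HeightOneSpectrum (𝓞 F) in cofinite, ρ.IsUnramifiedAt v) ∧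
        ∀ (v : HeightOneSpectrum (𝓞 F)) (hv : ((ℓ : ℕ) : 𝓞 F) ∈ v.asIdeal),
          (fontainePstAdicCompletion v ℓ hv).IsDeRhamFramed (ρ.toLocal v)) →
      (∀ (v : HeightOneSpectrum (𝓞 F)) (hv : ((ℓ : ℕ) : 𝓞 F) ∈ v.asIdeal),
          letI := (fontainePstAdicCompletion v ℓ hv).algebra
          ∀ τ : v.adicCompletion F →ₐ[ℚ_[ℓ]] PadicAlgCl ℓ, ∃ a b : ℤ, a < b ∧
            ρ.labelledHodgeTateWeightsAt v (fontainePstAdicCompletion v ℓ hv).algebra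
              (fontainePstAdicCompletion v ℓ hv).𝔅 τ.toRingHom = {a, b}) →
      Parallel F ℓ ρ → InSlice F ℓ ρ →
      ∃ π : CuspidalAutomorphicRepData 2 F hcpt, π.1.IsLAlgebraic ∧
        ∀ᶠ v : HeightOneSpectrum (𝓞 F) in cofinite, SatakeFrobCompatibleAt ι π.1 ρ v

/-- B_w⁺ OFF the generic-split slice (the declared residue of card A: `ℓ ≤ 3`, `ℓ` inert/ramified, residually
reducible / small / non-decomposed-generic, or residually non-automorphic `ρ̄`). [folklore] -/
def WeakParallelModularityOff : Prop :=
  ∀ (F : Type) [Field F] [NumberField F] [Algebra.IsQuadraticExtension ℚ F], NumberField.IsTotallyComplex F →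
    ∀ (hcpt : isCompact_glFiniteIntegralLevel 2 F) (ℓ : ℕ) [Fact ℓ.Prime] (ι : PadicAlgCl ℓ ≃+* ℂ)
      (ρ : FramedGaloisRep F (PadicAlgCl ℓ) 2), ρ.toGaloisRep.IsIrreducible →
      ((∀ᶠ v : HeightOneSpectrum (𝓞 F) in cofinite, ρ.IsUnramifiedAt v) ∧
        ∀ (v : HeightOneSpectrum (𝓞 F)) (hv : ((ℓ : ℕ) : 𝓞 F) ∈ v.asIdeal),
          (fontainePstAdicCompletion v ℓ hv).IsDeRhamFramed (ρ.toLocal v)) →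
      (∀ (v : HeightOneSpectrum (𝓞 F)) (hv : ((ℓ : ℕ) : 𝓞 F) ∈ v.asIdeal),
          letI := (fontainePstAdicCompletion v ℓ hv).algebra
          ∀ τ : v.adicCompletion F →ₐ[ℚ_[ℓ]] PadicAlgCl ℓ, ∃ a b : ℤ, a < b ∧
            ρ.labelledHodgeTateWeightsAt v (fontainePstAdicCompletion v ℓ hv).algebra
              (fontainePstAdicCompletion v ℓ hv).𝔅 τ.toRingHom = {a, b}) →
      Parallel F ℓ ρ → ¬ InSlice F ℓ ρ →
      ∃ π : CuspidalAutomorphicRepData 2 F hcpt, π.1.IsLAlgebraic ∧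
        ∀ᶠ v : HeightOneSpectrum (𝓞 F) in cofinite, SatakeFrobCompatibleAt ι π.1 ρ v

/-- THE CUT (card A): B_w⁺ = (on the slice) ⊓ (off the slice). Pure logic. [folklore] -/
theorem weakParallelModularity_of_cut (hon : WeakParallelModularityOn) (hoff : WeakParallelModularityOff) :
    WeakParallelModularity := by
  intro F _ _ _ hF hcpt ℓ _ ι ρ hirr hgeo hreg hpar
  by_cases hs : InSlice F ℓ ρ
  · exact hon F hF hcpt ℓ ι ρ hirr hgeo hreg hpar hs
  · exact hoff F hF hcpt ℓ ι ρ hirr hgeo hreg hpar hs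

/-! ## 3. Card A: ENTRANCE (big R = T ⇒ pro-modularity) and EXIT (pro-modular + de Rham regular ⇒ classical) -/

/-- **ENTRANCE — pro-modularity on the generic-split slice** (consequence of Gee–Newton's big `R = 𝕋` at defect
`ℓ₀ = 1`: [cite: GeeNewton2020, Prop. 4.4.x "big R = T" = Thm. 2 of the introduction], whose inputs (a) CG-vanishing
and (b) CE-codimension are KNOWN for `n = 2`, `F` imaginary quadratic (Rem. 55) and whose input (c) — fibre
codimension `j_{k[[K₀]]}(H̃_{1,𝔪}/ϖ) ≥ dim B = 2`, a Gelfand–Kirillov bound — is OPEN): every irreducible,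
a.e.-unramified `ρ : Γ_F → GL₂(ℚ̄_p)` on the slice is a continuous `ℚ̄_p`-point of the completed-cohomology
Hecke algebra of the Bianchi tower of SOME tame level. No `p`-adic Hodge hypothesis: weight-free and slope-free.
[cite: GeeNewton2020, Thm. 2 and Rem. 55] -/
def ProModularityGeneric : Prop :=
  ∀ (F : Type) [Field F] [NumberField F] [Algebra.IsQuadraticExtension ℚ F], NumberField.IsTotallyComplex F →
    ∀ (p : ℕ) [Fact p.Prime] (ρ : FramedGaloisRep F (PadicAlgCl p) 2), ρ.toGaloisRep.IsIrreducible →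
      (∀ᶠ v : HeightOneSpectrum (𝓞 F) in cofinite, ρ.IsUnramifiedAt v) → InSlice F p ρ →
      ∃ 𝒰 : BigHeckeGLn.TameLevel 2 F p, 𝒰.IsPadicallyAutomorphic ρ

/-- **EXIT — pro-modular + pinned-de Rham regular ⇒ classical, WEIGHT-FREE** (at split `p ≥ 5`: centre-level
local–global compatibility for the `𝔭_ρ`-part of completed cohomology + Colmez–Paškūnas `Π(ρ_v)^{alg} ≠ 0 ⟺ ρ_v`
de Rham regular + Emerton's edge map into `H¹(X_{K_pU^p}, V_λ)_𝔪`; the natural proof of the centre-level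
compatibility is Gee–Newton's "P gives the action", obtained from finite-level torsion local–global compatibility
for a CAPTURING family of `K₀`-types — Emerton–Paškūnas capture). The output `π` is cohomological of the
(necessarily parallel, Harder) weight of `ρ`; no `Parallel` hypothesis is needed, and none is used.
[cite: GeeNewton2020, Conj. 5.1.2, Cor. 5.1.x "modularity lifting" and Rem. 71]
[cite: Paskunas2013, Thm. 1.5] [cite: EmertonPaskunas2020, §1 (capture)] -/
def ProModularDeRhamClassical : Prop :=
  ∀ (F : Type) [Field F] [NumberField F] [Algebra.IsQuadraticExtension ℚ F], NumberField.IsTotallyComplex F →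
    ∀ (hcpt : isCompact_glFiniteIntegralLevel 2 F) (p : ℕ) [Fact p.Prime] (ι : PadicAlgCl p ≃+* ℂ)
      (ρ : FramedGaloisRep F (PadicAlgCl p) 2), ρ.toGaloisRep.IsIrreducible → InSlice F p ρ →
      (∃ 𝒰 : BigHeckeGLn.TameLevel 2 F p, 𝒰.IsPadicallyAutomorphic ρ) → DeRhamRegularAbove F p ρ →
      ∃ π : CuspidalAutomorphicRepData 2 F hcpt, π.1.IsLAlgebraic ∧
        ∀ᶠ v : HeightOneSpectrum (𝓞 F) in cofinite, SatakeFrobCompatibleAt ι π.1 ρ v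

/-- **FIRST LEMMA of card A (glue, PROVED): ENTRANCE → EXIT → B_w⁺ on the slice.** The `Parallel` hypothesis of
B_w⁺ is not consumed — on the engine's domain `Target` is a COROLLARY, not an input. [folklore] -/
theorem weakParallelModularityOn_of (h₁ : ProModularityGeneric) (h₂ : ProModularDeRhamClassical) :
    WeakParallelModularityOn := by
  intro F _ _ _ hF hcpt ℓ _ ι ρ hirr hgeo hreg hpar hs
  exact h₂ F hF hcpt ℓ ι ρ hirr hs (h₁ F hF ℓ ρ hirr hgeo.1 hs) ⟨hgeo.2, hreg⟩

/-- Card A's line shape for the crux's `Target`-fed stub: ENTRANCE → EXIT → OFF-slice residue → B_w⁺. [folklore] -/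
theorem weakParallelModularity_of (h₁ : ProModularityGeneric) (h₂ : ProModularDeRhamClassical)
    (hoff : WeakParallelModularityOff) : WeakParallelModularity :=
  weakParallelModularity_of_cut (weakParallelModularityOn_of h₁ h₂) hoff

/-! ## 4. Card B: the residually reducible Fontaine–Laffaille corner (Berger–Klosin engine), typed -/

/-- **EISENSTEIN CORNER, FL form** (the statement Berger–Klosin's idealised `R = T` addresses: [cite: BergerKlosin2015,
Thms. (mainthm2), (version2)] for weight 2; [cite: BergerKlosin2013, Thm. 9.14] in the one-dimensional Selmer case):
`F` imaginary quadratic, `p ≥ 5` unramified in `F`, `ρ` irreducible, a.e. unramified, residually NOT absolutely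
irreducible, crystalline for the pinned datum at every `v ∣ p` with distinct labelled weights, parallel with gap
`≤ p − 2` ⟹ Satake-level modularity. Open inputs named on the card (R-finiteness at defect one, multiplicity-free
Selmer, congruence-module bound); ordinary sub-corner = route SkinnerWilesDefectOne's `ReducibleOrdinaryModular`.
[cite: BergerKlosin2015, Thm. (mainthm2)] [cite: SkinnerWiles1999, Thm. A] -/
def EisensteinCornerFL : Prop :=
  ∀ (F : Type) [Field F] [NumberField F] [Algebra.IsQuadraticExtension ℚ F], NumberField.IsTotallyComplex F →
    ∀ (hcpt : isCompact_glFiniteIntegralLevel 2 F) (p : ℕ) [Fact p.Prime] (ι : PadicAlgCl p ≃+* ℂ)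
      (ρ : FramedGaloisRep F (PadicAlgCl p) 2), ρ.toGaloisRep.IsIrreducible →
      (∀ᶠ v : HeightOneSpectrum (𝓞 F) in cofinite, ρ.IsUnramifiedAt v) →
      ¬ ρ.IsResiduallyAbsIrreducible → 5 ≤ p → Algebra.IsUnramifiedIn (𝓞 F) (Ideal.span {(p : ℤ)}) →
      (∀ (v : HeightOneSpectrum (𝓞 F)) (hv : ((p : ℕ) : 𝓞 F) ∈ v.asIdeal),
          (fontainePstAdicCompletion v p hv).IsCrystallineFramed (ρ.toLocal v)) →
      DeRhamRegularAbove F p ρ → ParallelGapLE F p ρ ((p : ℤ) - 2) →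
      ∃ π : CuspidalAutomorphicRepData 2 F hcpt, π.1.IsLAlgebraic ∧
        ∀ᶠ v : HeightOneSpectrum (𝓞 F) in cofinite, SatakeFrobCompatibleAt ι π.1 ρ v

/-- B_w⁺ restricted to residually absolutely irreducible `ρ`. [folklore] -/
def WeakParallelModularityIrredResidue : Prop :=
  ∀ (F : Type) [Field F] [NumberField F] [Algebra.IsQuadraticExtension ℚ F], NumberField.IsTotallyComplex F →
    ∀ (hcpt : isCompact_glFiniteIntegralLevel 2 F) (ℓ : ℕ) [Fact ℓ.Prime] (ι : PadicAlgCl ℓ ≃+* ℂ)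
      (ρ : FramedGaloisRep F (PadicAlgCl ℓ) 2), ρ.toGaloisRep.IsIrreducible → ρ.IsResiduallyAbsIrreducible →
      ((∀ᶠ v : HeightOneSpectrum (𝓞 F) in cofinite, ρ.IsUnramifiedAt v) ∧
        ∀ (v : HeightOneSpectrum (𝓞 F)) (hv : ((ℓ : ℕ) : 𝓞 F) ∈ v.asIdeal),
          (fontainePstAdicCompletion v ℓ hv).IsDeRhamFramed (ρ.toLocal v)) →
      DeRhamRegularAbove F ℓ ρ → Parallel F ℓ ρ →
      ∃ π : CuspidalAutomorphicRepData 2 F hcpt, π.1.IsLAlgebraic ∧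
        ∀ᶠ v : HeightOneSpectrum (𝓞 F) in cofinite, SatakeFrobCompatibleAt ι π.1 ρ v

/-- B_w⁺ restricted to residually NOT absolutely irreducible `ρ` (the Eisenstein corner in full: FL part =
`EisensteinCornerFL`, ordinary part = `SkinnerWilesDefectOne.ReducibleOrdinaryModular` up to orientation,
dark part = non-FL non-ordinary). [folklore] -/
def WeakParallelModularityRedResidue : Prop :=
  ∀ (F : Type) [Field F] [NumberField F] [Algebra.IsQuadraticExtension ℚ F], NumberField.IsTotallyComplex F →
    ∀ (hcpt : isCompact_glFiniteIntegralLevel 2 F) (ℓ : ℕ) [Fact ℓ.Prime] (ι : PadicAlgCl ℓ ≃+* ℂ)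
      (ρ : FramedGaloisRep F (PadicAlgCl ℓ) 2), ρ.toGaloisRep.IsIrreducible → ¬ ρ.IsResiduallyAbsIrreducible →
      ((∀ᶠ v : HeightOneSpectrum (𝓞 F) in cofinite, ρ.IsUnramifiedAt v) ∧
        ∀ (v : HeightOneSpectrum (𝓞 F)) (hv : ((ℓ : ℕ) : 𝓞 F) ∈ v.asIdeal),
          (fontainePstAdicCompletion v ℓ hv).IsDeRhamFramed (ρ.toLocal v)) →
      DeRhamRegularAbove F ℓ ρ → Parallel F ℓ ρ →
      ∃ π : CuspidalAutomorphicRepData 2 F hcpt, π.1.IsLAlgebraic ∧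
        ∀ᶠ v : HeightOneSpectrum (𝓞 F) in cofinite, SatakeFrobCompatibleAt ι π.1 ρ v

/-- THE RESIDUE CUT (card B): B_w⁺ = (residually abs. irreducible) ⊓ (Eisenstein corner). Pure logic. [folklore] -/
theorem weakParallelModularity_of_residue_cut (hirr : WeakParallelModularityIrredResidue)
    (hred : WeakParallelModularityRedResidue) : WeakParallelModularity := by
  intro F _ _ _ hF hcpt ℓ _ ι ρ hρ hgeo hreg hpar
  by_cases h : ρ.IsResiduallyAbsIrreducible
  · exact hirr F hF hcpt ℓ ι ρ hρ h hgeo ⟨hgeo.2, hreg⟩ hpar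
  · exact hred F hF hcpt ℓ ι ρ hρ h hgeo ⟨hgeo.2, hreg⟩ hpar

end Summit.Langlands.Langlands.Cruxes.VoidToLanglands.DefectOnePincer

end
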